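import Literature.AlgebraicGeometry.HodgeTheory.HyperplaneSectionMonodromy
import Literature.AlgebraicGeometry.HodgeTheory.DirectImageTransport
import Literature.AlgebraicGeometry.HodgeTheory.TopDegreeClasses
import HarnessLib

/-!
# The monodromy package of a family from (homotopical) local triviality — proofs

Family `hodge`, layer `Literature/AlgebraicGeometry/HodgeTheory`. Proof file towards the named fact
`nonempty_universalHyperplaneSectionLocalSystem` (`HodgeTheory/HyperplaneSectionMonodromy`:
existence of the package `HyperplaneSectionLocalSystem` for the universal hyperplane section,
Voisin I Thm. 9.3 / §9.2.1 and Voisin II §3.1.2, §3.2.2–3.2.3). The printed proof has an ANALYTIC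
half — "`φ = pr₂` is a submersion with smooth fibre `X_H` over `H`" (Voisin II §3.2.2), so by
Ehresmann (Voisin I Thm. 9.3: "a diffeomorphism `T : 𝒳 ≅ X₀ × B` over `B`", `B` contractible) the
family is locally trivial over `U` — and a TOPOLOGICAL half — "as `B` is locally contractible […]
we deduce that `Rᵏ π_* A` is a local system […] the stalk at `t` is canonically isomorphic to
`Hᵏ(X_t, A)` by restriction" (Voisin I §9.2.1), monodromy "induced by homeomorphisms of the fibre"
hence "compatible with the cup-product" (Voisin II §3.1.2), and "a local subsystem `Ker J_*`"
(§3.2.3). This file completes the topological half for an arbitrary family `π : 𝒳 ⟶ S`,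
`j : 𝒳 ⟶ X`, on the tree's real carriers, and so REDUCES the named fact to the output of
Ehresmann's theorem for the universal family:

* `directImageLocalSystemOfRestrict π n hU hrat : DirectImageLocalSystem π n` — the interface of
  `HodgeTheory/HyperplaneSectionLocalSystem` inhabited from (i) cohomological local triviality of
  `π` over the smooth-fibre locus `U` by restriction (`IsCohomologicallyLocallyTrivialOn`, file
  `DirectImageCovering`) and (ii) rational descent along restriction over trivialising opens: the
  local systems are the monodromy functors `localSystemOfRestrict` (`DirectImageTransport`) with
  stalks `Hᵏ(X_s(ℂ); ℂ)` on the nose (`fiberIso = refl`), local triviality by restriction is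
  `transportFun_fiberRestrict`, multiplicativity `transportFun_cupProduct`, rationality
  `isRationalClass_transportFun`; `hyperplaneSectionLocalSystemOfRestrict` adds (iii) stability of
  the vanishing cohomology along restrictions of tube classes, via the continuation principle
  `transportFun_prop`.
* `IsHomotopicallyLocallyTrivialOn π U` — hypothesis structure: arbitrarily small open `B ⊆ U`
  with every fibre inclusion `X_s(ℂ) ↪ π⁻¹B(ℂ)`, `s ∈ B`, a homotopy equivalence (Ehresmann over
  balls). PROVED consequences: (i) (`isCohomologicallyLocallyTrivialOn`, homotopy invariance via
  `IsSpecialisingNhd.of_homotopyEquiv`), (ii) (`isRationalClass_of_homotopyEquiv`: pull back along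
  the homotopy inverse), (iii) (`fiberRestrict_mem_vanishing_of_homotopyEquiv`): by the projection
  formula `(j ∘ ι_s)_*(ξ|_{X_s}) = D_X⁻¹ (j_B)_*(ξ ⌢ (ι_s)_*[X_s(ℂ)])` (`complexGysin_fiberRestrict`)
  and the PROPORTIONALITY of the fundamental classes `(ι_s)_*[X_s(ℂ)]`, `s ∈ B`, in
  `H_{2n}(π⁻¹B(ℂ); ℂ)` (`exists_map_fundamentalClass_eq_smul`: `(ι_s)_*` is onto and
  `H_{2n}(X_s(ℂ); ℂ) = ℂ·[X_s(ℂ)]` for the closed connected manifold `X_s(ℂ)`, Hatcher 3.26(a) —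
  this is where every orientation family works: the kernel of the Gysin map ignores units).
* `hyperplaneSectionLocalSystemOfHomotopyEquiv`,
  `nonempty_hyperplaneSectionLocalSystem_of_isHomotopicallyLocallyTrivialOn` and the specialisation
  `nonempty_universalHyperplaneSectionLocalSystem_of_isHomotopicallyLocallyTrivialOn` — **the named
  fact for the universal hyperplane section follows from
  `IsHomotopicallyLocallyTrivialOn (UniversalHyperplaneSection.proj N ι) (universalSmoothLocus N ι n)`**.

What remains for `nonempty_universalHyperplaneSectionLocalSystem_holds` (not in this file, the
analytic half): that last hypothesis for `X ⊂ ℙᴺ_ℂ` smooth projective — Ehresmann's theorem (the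
tree's `AlgebraicTopology.Homotopy.ehresmann_fibration_holds`) for `π(ℂ)` over `U` (real-smooth
structure on `𝒳_U(ℂ)`, `π(ℂ)` a proper submersion there, `X_s(ℂ)` the topological fibre, `U` open),
with balls in charts of `U` as the small contractible `B`.

## References

* [VoisinHodgeI2002] C. Voisin, Hodge Theory and Complex Algebraic Geometry I, CUP 2002, Thm. 9.3,
  Rem. 9.4, §9.2.1.
* [VoisinHodgeII2003] C. Voisin, Hodge Theory and Complex Algebraic Geometry II, CUP 2003, §3.1.2,
  §3.2.2, §3.2.3.
* [HatcherAT2002] A. Hatcher, Algebraic Topology, CUP 2002, §3.1 p. 201, §3.3 Thm. 3.26(a), p. 241.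
-/

noncomputable section

open CategoryTheory AlgebraicGeometry
open _root_.Topology _root_.Filter
open Literature.AlgebraicTopology.SingularHomology

namespace Literature.AlgebraicGeometry.HodgeTheory

section HodgeTheory

variable {𝒳 S : Motives.SchemeOver ℂ} (π : 𝒳 ⟶ S)

/-! ### Assembly: the packages from local triviality hypotheses -/

section Assembly

variable (n : ℕ)

/-- **The local systems `Rᵏ π_* ℂ|_U` of a family from cohomological local triviality**: the
interface `DirectImageLocalSystem π n` is inhabited as soon as (i) every point of the smooth-fibre
locus `U` has arbitrarily small open neighbourhoods `B ⊆ U` over which restriction from the tube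
`Hᵏ(π⁻¹B(ℂ))` to every fibre `Hᵏ(X_s(ℂ))`, `s ∈ B`, is bijective in all degrees (for `π` smooth
and proper over `U`: Ehresmann's theorem, Voisin I Thm. 9.3, and homotopy invariance, §9.2.1), and
(ii) over such opens a tube class with a rational restriction is rational. The local systems are
the monodromy functors of the espaces étalés `FiberClass π k|_U → U` (covering spaces), with
stalks literally `Hᵏ(X_s(ℂ); ℂ)`. [cite: VoisinHodgeI2002, Thm. 9.3 and §9.2.1] [cite: VoisinHodgeII2003, §3.1.2] -/
def directImageLocalSystemOfRestrict
    (hU : IsCohomologicallyLocallyTrivialOn π (smoothFiberLocus π n))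
    (hrat : ∀ ⦃t : Motives.ComplexPoints S⦄, t ∈ smoothFiberLocus π n →
      ∃ B : Set (Motives.ComplexPoints S), IsOpen B ∧ t ∈ B ∧ B ⊆ smoothFiberLocus π n ∧
      (∀ (j : ℕ) ⦃s : Motives.ComplexPoints S⦄ (hs : s ∈ B), Function.Bijective (fiberRestrict π hs j)) ∧
      ∀ (j : ℕ) ⦃s : Motives.ComplexPoints S⦄ (hs : s ∈ B) (ξ : singularCohomology ℂ ℂ (tubeOver π B) j),
        IsRationalClass (fiberRestrict π hs j ξ) → IsRationalClass ξ) :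
    DirectImageLocalSystem π n where
  V k := localSystemOfRestrict π k hU
  fiberIso k s := LinearEquiv.refl ℂ _
  transport_restrict k s t γ := by
    ext A
    exact transportFun_map_fiberι π k hU γ A
  locallyTrivial s₀ := by
    obtain ⟨B, hBo, h₀B, -, hBU, hbij⟩ := hU.exists_nhds_bijective s₀.2 Set.univ univ_mem
    refine ⟨B, hBo, h₀B, hBU, fun k s hs ↦ hbij k hs, fun k s t hs ht γ hγ ↦ ?_⟩
    ext ξ
    exact transportFun_fiberRestrict π k hU hBo γ hγ hs ht ξ
  transport_cup h s t γ a b := transportFun_cupProduct π hU h γ a b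
  transport_isRationalClass k s t γ x hx := isRationalClass_transportFun π k hU hrat γ hx

/-- The transport of the package `directImageLocalSystemOfRestrict` on the real carriers is the
transport `transportFun` of the espace étalé (all identifications are identities). [folklore] -/
@[simp]
theorem directImageLocalSystemOfRestrict_transportBetti
    (hU : IsCohomologicallyLocallyTrivialOn π (smoothFiberLocus π n))
    (hrat : ∀ ⦃t : Motives.ComplexPoints S⦄, t ∈ smoothFiberLocus π n →
      ∃ B : Set (Motives.ComplexPoints S), IsOpen B ∧ t ∈ B ∧ B ⊆ smoothFiberLocus π n ∧
      (∀ (j : ℕ) ⦃s : Motives.ComplexPoints S⦄ (hs : s ∈ B), Function.Bijective (fiberRestrict π hs j)) ∧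
      ∀ (j : ℕ) ⦃s : Motives.ComplexPoints S⦄ (hs : s ∈ B) (ξ : singularCohomology ℂ ℂ (tubeOver π B) j),
        IsRationalClass (fiberRestrict π hs j ξ) → IsRationalClass ξ)
    (k : ℕ) {s t : smoothFiberLocus π n} (γ : Path.Homotopic.Quotient s t)
    (x : complexBetti (Motives.fiberOver π s.1) k) :
    (directImageLocalSystemOfRestrict π n hU hrat).transportBetti k γ x = transportFun π k hU γ x :=
  rfl

variable {X : Motives.SchemeOver ℂ} (j : 𝒳 ⟶ X)

/-- **The hyperplane-section package from local triviality hypotheses**: in addition to the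
hypotheses of `directImageLocalSystemOfRestrict`, assume (iii) over trivialising opens the
vanishing cohomology is carried along restrictions of tube classes — "`Ker J_*` is a local
subsystem" (for `π` smooth proper over `U` this follows from the projection formula and the
constancy of the fundamental classes of the fibres in the tube). Then
`HyperplaneSectionLocalSystem π n j` is inhabited. [cite: VoisinHodgeII2003, §3.2.3] -/
def hyperplaneSectionLocalSystemOfRestrict
    (hU : IsCohomologicallyLocallyTrivialOn π (smoothFiberLocus π n))
    (hrat : ∀ ⦃t : Motives.ComplexPoints S⦄, t ∈ smoothFiberLocus π n →
      ∃ B : Set (Motives.ComplexPoints S), IsOpen B ∧ t ∈ B ∧ B ⊆ smoothFiberLocus π n ∧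
      (∀ (j : ℕ) ⦃s : Motives.ComplexPoints S⦄ (hs : s ∈ B), Function.Bijective (fiberRestrict π hs j)) ∧
      ∀ (j : ℕ) ⦃s : Motives.ComplexPoints S⦄ (hs : s ∈ B) (ξ : singularCohomology ℂ ℂ (tubeOver π B) j),
        IsRationalClass (fiberRestrict π hs j ξ) → IsRationalClass ξ)
    (hvan : ∀ (μ : OrientationFamily) {m b : ℕ} (hX : Motives.IsSmoothProjective m X)
      (hb : n + 2 * m = b + 2 * n) ⦃t : Motives.ComplexPoints S⦄, t ∈ smoothFiberLocus π n →
      ∃ B : Set (Motives.ComplexPoints S), IsOpen B ∧ t ∈ B ∧ B ⊆ smoothFiberLocus π n ∧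
      (∀ (j : ℕ) ⦃s : Motives.ComplexPoints S⦄ (hs : s ∈ B), Function.Bijective (fiberRestrict π hs j)) ∧
      ∀ (ξ : singularCohomology ℂ ℂ (tubeOver π B) n) ⦃s s' : Motives.ComplexPoints S⦄
        (hs : s ∈ smoothFiberLocus π n) (hs' : s' ∈ smoothFiberLocus π n) (hsB : s ∈ B) (hs'B : s' ∈ B),
        fiberRestrict π hsB n ξ ∈ vanishing π n j μ hX hb ⟨s, hs⟩ →
          fiberRestrict π hs'B n ξ ∈ vanishing π n j μ hX hb ⟨s', hs'⟩) :
    HyperplaneSectionLocalSystem π n j where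
  toDirectImageLocalSystem := directImageLocalSystemOfRestrict π n hU hrat
  transport_vanishing μ m b hX hb s t γ x hx := by
    change transportFun π n hU γ x ∈ vanishing π n j μ hX hb t
    refine transportFun_prop π n hU
      (fun t' y ↦ ∀ ht' : t' ∈ smoothFiberLocus π n, y ∈ vanishing π n j μ hX hb ⟨t', ht'⟩)
      (fun t' ht' ↦ ?_) γ (fun _ ↦ hx) t.2
    obtain ⟨B, hBo, htB, hBU, hbij, hB⟩ := hvan μ hX hb ht'
    exact ⟨B, hBo, htB, hBU, hbij, fun ξ s s' hs hs' h hs'U ↦ hB ξ (hBU hs) hs'U hs hs' (h (hBU hs))⟩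

end Assembly

/-! ### Homotopical local triviality and its consequences -/

section HomotopyEquiv

variable {U : Set (Motives.ComplexPoints S)}

/-- **Homotopical local triviality of `π` over `U ⊆ S(ℂ)`** (hypothesis structure): every point of
`U` has arbitrarily small open neighbourhoods `B ⊆ U` such that for every `s ∈ B` the inclusion of
the fibre `X_s(ℂ) ↪ π⁻¹B(ℂ)` (`fiberToTube`) underlies a homotopy equivalence. For `π(ℂ)` a proper
submersion over an open `U` of a manifold this is Ehresmann's theorem over balls `B`
("there exists a diffeomorphism `T : 𝒳 ≅ X₀ × B` over `B`", `B` contractible); it is the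
topological input from which the monodromy package is built. [cite: VoisinHodgeI2002, Thm. 9.3 (with Rem. 9.4)] -/
structure IsHomotopicallyLocallyTrivialOn (U : Set (Motives.ComplexPoints S)) : Prop where
  /-- Arbitrarily small open tubes inside `U` retracting onto each of their fibres. -/
  exists_nhds_homotopyEquiv : ∀ ⦃t : Motives.ComplexPoints S⦄, t ∈ U → ∀ W ∈ 𝓝 t,
    ∃ B : Set (Motives.ComplexPoints S), IsOpen B ∧ t ∈ B ∧ B ⊆ W ∧ B ⊆ U ∧
      ∀ ⦃s : Motives.ComplexPoints S⦄ (hs : s ∈ B),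
        ∃ e : ContinuousMap.HomotopyEquiv (Motives.ComplexPoints (Motives.fiberOver π s)) (tubeOver π B),
          e.toFun = fiberToTube π hs

/-- The empty locus is (vacuously) homotopically locally trivial. [folklore] -/
theorem isHomotopicallyLocallyTrivialOn_empty :
    IsHomotopicallyLocallyTrivialOn π (∅ : Set (Motives.ComplexPoints S)) :=
  ⟨fun _ ht ↦ ht.elim⟩

/-- **Homotopical ⟹ cohomological local triviality** (homotopy invariance of singular
cohomology, through the tree's `IsSpecialisingNhd.of_homotopyEquiv`).
[cite: VoisinHodgeI2002, §9.2.1] -/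
theorem IsHomotopicallyLocallyTrivialOn.isCohomologicallyLocallyTrivialOn
    (hU : IsHomotopicallyLocallyTrivialOn π U) : IsCohomologicallyLocallyTrivialOn π U := by
  refine ⟨fun t ht W hW ↦ ?_⟩
  obtain ⟨B, hBo, htB, hBW, hBU, he⟩ := hU.exists_nhds_homotopyEquiv ht W hW
  refine ⟨B, hBo, htB, hBW, hBU, fun j s hs ↦ ?_⟩
  obtain ⟨e, he⟩ := he hs
  exact (IsSpecialisingNhd.of_homotopyEquiv hBo hs e he j).bijective

/-- Over a tube retracting onto the fibre `X_s(ℂ)`, a tube class whose restriction to `X_s(ℂ)` is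
rational is rational (pull back along the homotopy inverse). [cite: HatcherAT2002, §3.1 p. 201] -/
theorem isRationalClass_of_homotopyEquiv {B : Set (Motives.ComplexPoints S)} {s : Motives.ComplexPoints S}
    (hs : s ∈ B)
    (e : ContinuousMap.HomotopyEquiv (Motives.ComplexPoints (Motives.fiberOver π s)) (tubeOver π B))
    (he : e.toFun = fiberToTube π hs) {j : ℕ} (ξ : singularCohomology ℂ ℂ (tubeOver π B) j)
    (hξ : IsRationalClass (fiberRestrict π hs j ξ)) : IsRationalClass ξ := by
  have h : singularCohomology.map ℂ ℂ e.invFun j (fiberRestrict π hs j ξ) = ξ := by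
    rw [fiberRestrict, ← he, ← ModuleCat.comp_apply, ← singularCohomology.map_comp,
      singularCohomology.map_eq_of_homotopic' ℂ ℂ e.right_inv, singularCohomology.map_id]
    rfl
  rw [← h]
  exact hξ.map _

/-! ### Fundamental classes of the fibres inside a tube -/

/-- On `Y(ℂ)`, `Y` smooth projective of dimension `n`, every top-degree homology class is a
multiple of the fundamental class of any `ℂ`-orientation (`H_{2n}(Y(ℂ); ℂ) → H_{2n}(Y(ℂ) | x; ℂ) ≅ ℂ`
is an isomorphism on the closed connected manifold `Y(ℂ)`, Hatcher Thm. 3.26(a), and `[Y(ℂ)]`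
hits the generator). [cite: HatcherAT2002, §3.3 Thm. 3.26(a)] -/
theorem exists_eq_smul_fundamentalClass {n : ℕ} {Y : Motives.SchemeOver ℂ}
    (hY : Motives.IsSmoothProjective n Y)
    (ν : HomologicalOrientation ℂ (Motives.ComplexPoints Y) (2 * n))
    (y : singularHomology ℂ ℂ (Motives.ComplexPoints Y) (2 * n)) :
    ∃ c : ℂ, y = c • ν.fundamentalClass := by
  letI := hY.chartedSpace
  haveI := Motives.ComplexPoints.compactSpace_of_isSmoothProjective hY
  haveI := Motives.ComplexPoints.t2Space_of_isSmoothProjective hY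
  haveI := connectedSpace_complexPoints hY
  obtain ⟨x⟩ := (inferInstance : Nonempty (Motives.ComplexPoints Y))
  haveI := singularHomology.isIso_toLocal_of_orientation ν x
  have hinj : Function.Injective (singularHomology.toLocal ℂ ℂ x (2 * n)) :=
    ((ConcreteCategory.isIso_iff_bijective _).1 inferInstance).1
  have hfc := Motives.ComplexPoints.isFundamentalClass_fundamentalClass hY ν x
  obtain ⟨e, he⟩ := ν.isGenerator x
  refine ⟨e (singularHomology.toLocal ℂ ℂ x (2 * n) y), hinj (e.injective ?_)⟩
  rw [map_smul, map_smul, hfc, he, smul_eq_mul, mul_one]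

/-- **The fundamental classes of the smooth fibres of a tube retracting onto each fibre are
proportional** in `H_{2n}(π⁻¹B(ℂ); ℂ)`. [cite: VoisinHodgeII2003, §3.2.3] -/
theorem exists_map_fundamentalClass_eq_smul {n : ℕ} {B : Set (Motives.ComplexPoints S)}
    {s s' : Motives.ComplexPoints S} (hs : Motives.IsSmoothProjective n (Motives.fiberOver π s))
    (hsB : s ∈ B) (hs'B : s' ∈ B)
    (e : ContinuousMap.HomotopyEquiv (Motives.ComplexPoints (Motives.fiberOver π s)) (tubeOver π B))
    (he : e.toFun = fiberToTube π hsB)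
    (ν : HomologicalOrientation ℂ (Motives.ComplexPoints (Motives.fiberOver π s)) (2 * n))
    (ν' : HomologicalOrientation ℂ (Motives.ComplexPoints (Motives.fiberOver π s')) (2 * n)) :
    ∃ c : ℂ, singularHomology.map ℂ ℂ (fiberToTube π hs'B) (2 * n) ν'.fundamentalClass =
      c • singularHomology.map ℂ ℂ (fiberToTube π hsB) (2 * n) ν.fundamentalClass := by
  obtain ⟨y, hy⟩ := (singularHomology.isoOfHomotopyEquiv ℂ ℂ e (2 * n)).toLinearEquiv.surjective
    (singularHomology.map ℂ ℂ (fiberToTube π hs'B) (2 * n) ν'.fundamentalClass)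
  obtain ⟨c, rfl⟩ := exists_eq_smul_fundamentalClass hs ν y
  refine ⟨c, ?_⟩
  rw [← hy, map_smul]
  congr 1
  change singularHomology.map ℂ ℂ e.toFun (2 * n) _ = _
  rw [he]

/-! ### The Gysin map of a restricted tube class -/

variable {X : Motives.SchemeOver ℂ} (j : 𝒳 ⟶ X)

/-- The map `π⁻¹B(ℂ) → X(ℂ)` induced by `j : 𝒳 ⟶ X` on a tube. [folklore] -/
def tubeToTarget (B : Set (Motives.ComplexPoints S)) : C(tubeOver π B, Motives.ComplexPoints X) :=
  (Motives.AlgPoints.mapContinuous (L := ℂ) j).comp ⟨Subtype.val, continuous_subtype_val⟩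

/-- `(j ∘ ι_s)(ℂ) = (j on the tube) ∘ (fibre-to-tube)`. [folklore] -/
theorem mapContinuous_fiberι_comp {B : Set (Motives.ComplexPoints S)} {s : Motives.ComplexPoints S}
    (hs : s ∈ B) :
    Motives.AlgPoints.mapContinuous (L := ℂ) (Motives.fiberι π s ≫ j) =
      (tubeToTarget π j B).comp (fiberToTube π hs) := by
  ext P : 1
  exact Motives.AlgPoints.map_comp_apply _ _ P

/-- **The Gysin morphism of a restricted tube class**: for `s ∈ U` in a tube over `B`,
`(j ∘ ι_s)_* (ξ|_{X_s}) = D_X⁻¹ (j_B)_* (ξ ⌢ (ι_s)_*[X_s(ℂ)])` (projection formula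
`f_*(f^*ξ ⌢ c) = ξ ⌢ f_*c`). [cite: HatcherAT2002, §3.3 p. 241] [cite: VoisinHodgeII2003, §3.2.3] -/
theorem complexGysin_fiberRestrict (μ : OrientationFamily) {n m b : ℕ}
    (hX : Motives.IsSmoothProjective m X) (hb : n + 2 * m = b + 2 * n)
    {B : Set (Motives.ComplexPoints S)} {s : Motives.ComplexPoints S}
    (hs : Motives.IsSmoothProjective n (Motives.fiberOver π s)) (hsB : s ∈ B)
    (ξ : singularCohomology ℂ ℂ (tubeOver π B) n) :
    complexGysin μ hs hX (Motives.fiberι π s ≫ j) hb (fiberRestrict π hsB n ξ) =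
      poincareDualityInv (μ hX) (show b + n = 2 * m by omega)
        (singularHomology.map ℂ ℂ (tubeToTarget π j B) n
          (capProduct (show n + n = 2 * n by omega) ξ
            (singularHomology.map ℂ ℂ (fiberToTube π hsB) (2 * n) (μ hs).fundamentalClass))) := by
  rw [complexGysin_eq_gysinMap hs hX _ hb (show n + n = 2 * n by omega) (show b + n = 2 * m by omega),
    gysinMap_apply, mapContinuous_fiberι_comp π j hsB, singularHomology.map_comp, ModuleCat.comp_apply,
    fiberRestrict, capProduct_map]

/-- **Stability of the vanishing cohomology along restrictions over a tube retracting onto its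
fibres** ("a local subsystem `Ker J_*`"): if `ξ|_{X_s} ∈ Hⁿ(X_s)_van` then `ξ|_{X_{s'}} ∈ Hⁿ(X_{s'})_van`
for smooth fibres `X_s`, `X_{s'}` of the tube — the fundamental classes of the fibres being
proportional in the tube. [cite: VoisinHodgeII2003, §3.2.3] -/
theorem fiberRestrict_mem_vanishing_of_homotopyEquiv (n : ℕ) (μ : OrientationFamily) {m b : ℕ}
    (hX : Motives.IsSmoothProjective m X) (hb : n + 2 * m = b + 2 * n)
    {B : Set (Motives.ComplexPoints S)} {s s' : smoothFiberLocus π n} (hsB : s.1 ∈ B) (hs'B : s'.1 ∈ B)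
    (e : ContinuousMap.HomotopyEquiv (Motives.ComplexPoints (Motives.fiberOver π s.1)) (tubeOver π B))
    (he : e.toFun = fiberToTube π hsB) (ξ : singularCohomology ℂ ℂ (tubeOver π B) n)
    (hξ : fiberRestrict π hsB n ξ ∈ vanishing π n j μ hX hb s) :
    fiberRestrict π hs'B n ξ ∈ vanishing π n j μ hX hb s' := by
  rw [mem_vanishing_iff, complexGysin_fiberRestrict] at hξ ⊢
  obtain ⟨c, hc⟩ := exists_map_fundamentalClass_eq_smul π s.2 hsB hs'B e he (μ s.2) (μ s'.2)
  rw [hc, map_smul, map_smul, map_smul, hξ, smul_zero]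

/-! ### The packages from homotopical local triviality -/

variable (n : ℕ)

/-- **The hyperplane-section package from homotopical local triviality** of `π` over the
smooth-fibre locus: `HyperplaneSectionLocalSystem π n j` inhabited by the monodromy of the espaces
étalés, all three hypotheses of `hyperplaneSectionLocalSystemOfRestrict` being consequences of the
homotopy equivalences `X_s(ℂ) ≃ π⁻¹B(ℂ)` (homotopy invariance; rational descent along the
homotopy inverse; proportionality of the fundamental classes of the fibres in a tube).
[cite: VoisinHodgeI2002, Thm. 9.3 and §9.2.1] [cite: VoisinHodgeII2003, §3.1.2 and §3.2.3] -/
def hyperplaneSectionLocalSystemOfHomotopyEquiv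
    (hU : IsHomotopicallyLocallyTrivialOn π (smoothFiberLocus π n)) :
    HyperplaneSectionLocalSystem π n j :=
  hyperplaneSectionLocalSystemOfRestrict π n j hU.isCohomologicallyLocallyTrivialOn
    (fun t ht ↦ by
      obtain ⟨B, hBo, htB, -, hBU, he⟩ := hU.exists_nhds_homotopyEquiv ht Set.univ univ_mem
      refine ⟨B, hBo, htB, hBU, fun j s hs ↦ ?_, fun j s hs ξ hξ ↦ ?_⟩
      · obtain ⟨e, he⟩ := he hs
        exact (IsSpecialisingNhd.of_homotopyEquiv hBo hs e he j).bijective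
      · obtain ⟨e, he⟩ := he hs
        exact isRationalClass_of_homotopyEquiv π hs e he ξ hξ)
    (fun μ m b hX hb t ht ↦ by
      obtain ⟨B, hBo, htB, -, hBU, he⟩ := hU.exists_nhds_homotopyEquiv ht Set.univ univ_mem
      refine ⟨B, hBo, htB, hBU, fun j s hs ↦ ?_, fun ξ s s' hs hs' hsB hs'B hξ ↦ ?_⟩
      · obtain ⟨e, he⟩ := he hs
        exact (IsSpecialisingNhd.of_homotopyEquiv hBo hs e he j).bijective
      · obtain ⟨e, he⟩ := he hsB
        exact fiberRestrict_mem_vanishing_of_homotopyEquiv π j n μ hX hb (s := ⟨s, hs⟩) (s' := ⟨s', hs'⟩)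
          hsB hs'B e he ξ hξ)

/-- The real-carrier transport of the package is the transport of the espace étalé. [folklore] -/
theorem hyperplaneSectionLocalSystemOfHomotopyEquiv_transportBetti
    (hU : IsHomotopicallyLocallyTrivialOn π (smoothFiberLocus π n)) (k : ℕ)
    {s t : smoothFiberLocus π n} (γ : Path.Homotopic.Quotient s t)
    (x : complexBetti (Motives.fiberOver π s.1) k) :
    (hyperplaneSectionLocalSystemOfHomotopyEquiv π j n hU).transportBetti k γ x =
      transportFun π k hU.isCohomologicallyLocallyTrivialOn γ x :=
  rfl

/-- **Existence of the hyperplane-section package from homotopical local triviality.**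
[cite: VoisinHodgeI2002, Thm. 9.3 and §9.2.1] [cite: VoisinHodgeII2003, §3.2.2–3.2.3] -/
theorem nonempty_hyperplaneSectionLocalSystem_of_isHomotopicallyLocallyTrivialOn
    (hU : IsHomotopicallyLocallyTrivialOn π (smoothFiberLocus π n)) :
    Nonempty (HyperplaneSectionLocalSystem π n j) :=
  ⟨hyperplaneSectionLocalSystemOfHomotopyEquiv π j n hU⟩

end HomotopyEquiv

/-! ### The universal hyperplane section (homotopical form) -/

/-- **The named fact reduced to Ehresmann-type local triviality of the universal hyperplane
section**: if `π = pr₂ : 𝒳 ⟶ (ℙᴺ)^*` is homotopically locally trivial over the locus `U` of smooth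
`n`-dimensional hyperplane sections of `ι : X ⟶ ℙᴺ_ℂ` — every point of `U` has arbitrarily small
open `B ⊆ U` with `X_s(ℂ) ↪ π⁻¹B(ℂ)` a homotopy equivalence for all `s ∈ B`, which is what
Ehresmann's theorem ("`φ = pr₂` is a submersion with smooth fibre `X_H` over `H`", Voisin II §3.2.2;
Voisin I Thm. 9.3) provides over balls of `U` — then the monodromy package
`UniversalHyperplaneSectionLocalSystem N ι n` exists. [cite: VoisinHodgeII2003, §3.2.2–3.2.3] [cite: VoisinHodgeI2002, Thm. 9.3 and §9.2.1] -/
theorem nonempty_universalHyperplaneSectionLocalSystem_of_isHomotopicallyLocallyTrivialOn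
    (N n : ℕ) {X : Motives.SchemeOver ℂ} (ι : X ⟶ Motives.projectiveSpace N ℂ)
    (hU : IsHomotopicallyLocallyTrivialOn (Motives.UniversalHyperplaneSection.proj N ι)
      (universalSmoothLocus N ι n)) :
    Nonempty (UniversalHyperplaneSectionLocalSystem N ι n) :=
  nonempty_hyperplaneSectionLocalSystem_of_isHomotopicallyLocallyTrivialOn _ _ n hU

end HodgeTheory

end Literature.AlgebraicGeometry.HodgeTheory

end
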